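import Summits.Parity.BatemanHorn.Theorems.SoloInformedConjEIffLargeDivisors

/-!
# The tiers of Landau's `n² + 1` problem, read on one quantity

Notation (informal): `ψ(x) = ∑_{n ≤ x} Λ(n²+1)`, `π_E(x) = #{n ≤ x : n²+1 prime}`,
`𝔖 = hardyLittlewoodEConst`, and, for a fixed `0 < ε < 1`,
`T(x) = ∑_{n ≤ x} ∑_{d ∣ n²+1, d > ⌊x^{1-ε}⌋} μ(d) log d` (below always indexed by the cofactor
`e = (n²+1)/d`). The exact identity of `SoloInformedLargeDivisorEquivalence` together with the
unconditional first range `(R1)` (`tendsto_neg_sum_moebius_log_rho_div`) reads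
`ψ(x) = 𝔖·x + E(x) - T(x)` with `E(x) = o(x)` a THEOREM (`sum_vonMangoldt_eq_main_sub_largeDivisorSum`,
`eventually_abs_mainError_le`). So, at resolution `o(x)`, the lower and upper orders of `ψ` and of
`T` determine each other, and the classical ladder of statements about primes `n² + 1` becomes a
ladder of one-sided bounds for the single sum `T`:

* Tier 0 (proved): `T(x) ≤ (𝔖 + o(1))·x` — this is `ψ ≥ 0` and nothing more
  (`eventually_largeDivisorSum_le`). The trivial bound is `𝔖·x` on the nose.
* Tier 1 (Landau's conjecture, quantitative forms): saving ANY fixed constant below Tier 0,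
  `T(x) ≤ (𝔖 - c)·x` for some `c > 0` — along a sequence, resp. for all large `x` — is equivalent to
  `ψ(x) ≥ c'·x`, equivalently `π_E(x) ≥ c''·x/log x`, along a sequence, resp. eventually
  (`frequently_linear_le_iff_largeDivisorSum`, `eventually_linear_le_iff_largeDivisorSum`,
  `frequently_linear_le_iff_primeCount`, `eventually_linear_le_iff_primeCount`), and the sequence
  version already gives `LandauConjecture` (`landauConjecture_of_frequently_largeDivisorSum_le`).
* Tier 2 (sharp one-sided constants): `T(x) ≥ -o(x)` ⟺ `ψ(x) ≤ (𝔖 + o(1))·x`, and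
  `T(x) ≤ o(x)` ⟺ `ψ(x) ≥ (𝔖 - o(1))·x` (`upper_iff_largeDivisorSum_ge`, `lower_iff_largeDivisorSum_le`).
* Tier 3 (Hardy–Littlewood E): both sides of Tier 2, i.e. `T(x) = o(x)`
  (`hardyLittlewoodConjE_iff_largeDivisorSum_twoSided`; cf.
  `hardyLittlewoodConjE_iff_largeDivisorSum_isLittleO`).

Nothing here is deep; the point recorded is that in these coordinates the parity-sensitive content
of every tier is a one-sided bound for the same explicit Möbius–log sum over the divisors
`d > x^{1-ε}` of `n² + 1`, the trivial bound being exactly the Tier-0 constant `𝔖`.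
-/

namespace Summit.Parity.BatemanHorn.Theorems

open Finset Filter ArithmeticFunction Asymptotics
open scoped ArithmeticFunction.Moebius Topology
open Literature.NumberTheory.Sieve (hardyLittlewoodEConst hardyLittlewoodEConst_pos
  HardyLittlewoodConjE nSqAddOnePrimeCount LandauConjecture tendsto_natCast_div_log_atTop)
open Literature.NumberTheory.Sieve.Iwaniec1978 (rho rem)

/-! ### The identity `ψ = 𝔖 x + E - T` and `E = o(x)` -/

/-- `ψ(x) = 𝔖·x + E(x) - T(x)` (exact, every `x`, every `ε`). -/
theorem sum_vonMangoldt_eq_main_sub_largeDivisorSum (x : ℕ) (ε : ℝ) :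
    ∑ n ∈ Icc 1 x, Λ (n ^ 2 + 1)
      = hardyLittlewoodEConst * x
        + ((x : ℝ) * ((-∑ d ∈ Icc 1 ⌊(x : ℝ) ^ (1 - ε)⌋₊, (μ d : ℝ) * Real.log d * rho d / d)
              - hardyLittlewoodEConst)
            - ∑ d ∈ Icc 1 ⌊(x : ℝ) ^ (1 - ε)⌋₊, (μ d : ℝ) * Real.log d * rem (x : ℝ) d)
        - ∑ n ∈ Icc 1 x, ∑ e ∈ (n ^ 2 + 1).divisors with ⌊(x : ℝ) ^ (1 - ε)⌋₊ < (n ^ 2 + 1) / e,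
            (μ ((n ^ 2 + 1) / e) : ℝ) * Real.log (((n ^ 2 + 1) / e : ℕ) : ℝ) := by
  have h := sum_vonMangoldt_sub_add_largeDivisorSum_eq x ⌊(x : ℝ) ^ (1 - ε)⌋₊ hardyLittlewoodEConst
  linarith

/-- `E(x) = o(x)`, unconditionally: `|E(x)| ≤ c·x` eventually, for every `c > 0`. -/
theorem eventually_abs_mainError_le {ε : ℝ} (hε : 0 < ε) (hε1 : ε < 1) {c : ℝ} (hc : 0 < c) :
    ∀ᶠ x : ℕ in atTop,
      |(x : ℝ) * ((-∑ d ∈ Icc 1 ⌊(x : ℝ) ^ (1 - ε)⌋₊, (μ d : ℝ) * Real.log d * rho d / d)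
            - hardyLittlewoodEConst)
          - ∑ d ∈ Icc 1 ⌊(x : ℝ) ^ (1 - ε)⌋₊, (μ d : ℝ) * Real.log d * rem (x : ℝ) d|
        ≤ c * x := by
  have h := (mainError_isLittleO hε hε1 tendsto_neg_sum_moebius_log_rho_div).bound hc
  filter_upwards [h] with x hx
  simpa only [Real.norm_eq_abs, Nat.abs_cast] using hx

/-! ### Tier 0: the trivial bound is `𝔖 x` -/

/-- **Tier 0.** `T(x) ≤ (𝔖 + δ)·x` eventually, for every `δ > 0` — equivalently `ψ(x) ≥ 0`. -/
theorem eventually_largeDivisorSum_le {ε : ℝ} (hε : 0 < ε) (hε1 : ε < 1) {δ : ℝ} (hδ : 0 < δ) :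
    ∀ᶠ x : ℕ in atTop,
      ∑ n ∈ Icc 1 x, ∑ e ∈ (n ^ 2 + 1).divisors with ⌊(x : ℝ) ^ (1 - ε)⌋₊ < (n ^ 2 + 1) / e,
          (μ ((n ^ 2 + 1) / e) : ℝ) * Real.log (((n ^ 2 + 1) / e : ℕ) : ℝ)
        ≤ (hardyLittlewoodEConst + δ) * x := by
  filter_upwards [eventually_abs_mainError_le hε hε1 hδ] with x hE
  have hid := sum_vonMangoldt_eq_main_sub_largeDivisorSum x ε
  have hψ : 0 ≤ ∑ n ∈ Icc 1 x, Λ (n ^ 2 + 1) := sum_nonneg fun _ _ => vonMangoldt_nonneg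
  have := (abs_le.mp hE).2
  linarith

/-! ### Tier 1: any constant saving is Landau's conjecture -/

/-- **Tier 1, along a sequence.** `ψ(x) ≥ c·x` for some `c > 0` and arbitrarily large `x`
⟺ `T(x) ≤ (𝔖 - c)·x` for some `c > 0` and arbitrarily large `x`. -/
theorem frequently_linear_le_iff_largeDivisorSum {ε : ℝ} (hε : 0 < ε) (hε1 : ε < 1) :
    (∃ c : ℝ, 0 < c ∧ ∃ᶠ x : ℕ in atTop, c * x ≤ ∑ n ∈ Icc 1 x, Λ (n ^ 2 + 1))
      ↔ ∃ c : ℝ, 0 < c ∧ ∃ᶠ x : ℕ in atTop,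
          ∑ n ∈ Icc 1 x, ∑ e ∈ (n ^ 2 + 1).divisors with ⌊(x : ℝ) ^ (1 - ε)⌋₊ < (n ^ 2 + 1) / e,
              (μ ((n ^ 2 + 1) / e) : ℝ) * Real.log (((n ^ 2 + 1) / e : ℕ) : ℝ)
            ≤ (hardyLittlewoodEConst - c) * x := by
  constructor
  · rintro ⟨c, hc, h⟩
    refine ⟨c / 2, half_pos hc, ?_⟩
    refine (h.and_eventually (eventually_abs_mainError_le hε hε1 (half_pos hc))).mono ?_
    rintro x ⟨hx, hE⟩
    have hid := sum_vonMangoldt_eq_main_sub_largeDivisorSum x ε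
    have := (abs_le.mp hE).2
    linarith
  · rintro ⟨c, hc, h⟩
    refine ⟨c / 2, half_pos hc, ?_⟩
    refine (h.and_eventually (eventually_abs_mainError_le hε hε1 (half_pos hc))).mono ?_
    rintro x ⟨hx, hE⟩
    have hid := sum_vonMangoldt_eq_main_sub_largeDivisorSum x ε
    have := (abs_le.mp hE).1
    linarith

/-- **Tier 1, eventually.** `ψ(x) ≥ c·x` for some `c > 0` and all large `x`
⟺ `T(x) ≤ (𝔖 - c)·x` for some `c > 0` and all large `x`. -/
theorem eventually_linear_le_iff_largeDivisorSum {ε : ℝ} (hε : 0 < ε) (hε1 : ε < 1) :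
    (∃ c : ℝ, 0 < c ∧ ∀ᶠ x : ℕ in atTop, c * x ≤ ∑ n ∈ Icc 1 x, Λ (n ^ 2 + 1))
      ↔ ∃ c : ℝ, 0 < c ∧ ∀ᶠ x : ℕ in atTop,
          ∑ n ∈ Icc 1 x, ∑ e ∈ (n ^ 2 + 1).divisors with ⌊(x : ℝ) ^ (1 - ε)⌋₊ < (n ^ 2 + 1) / e,
              (μ ((n ^ 2 + 1) / e) : ℝ) * Real.log (((n ^ 2 + 1) / e : ℕ) : ℝ)
            ≤ (hardyLittlewoodEConst - c) * x := by
  constructor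
  · rintro ⟨c, hc, h⟩
    refine ⟨c / 2, half_pos hc, ?_⟩
    filter_upwards [h, eventually_abs_mainError_le hε hε1 (half_pos hc)] with x hx hE
    have hid := sum_vonMangoldt_eq_main_sub_largeDivisorSum x ε
    have := (abs_le.mp hE).2
    linarith
  · rintro ⟨c, hc, h⟩
    refine ⟨c / 2, half_pos hc, ?_⟩
    filter_upwards [h, eventually_abs_mainError_le hε hε1 (half_pos hc)] with x hx hE
    have hid := sum_vonMangoldt_eq_main_sub_largeDivisorSum x ε
    have := (abs_le.mp hE).1
    linarith

/-- From `ψ` to `π_E` at a fixed `x ≥ 3`: if the proper prime powers weigh `≤ (c/2)·x` and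
`c·x ≤ ψ(x)` then `(c/6)·x/log x ≤ π_E(x)` (via `θ ≤ π_E · log(x²+1) ≤ 3 π_E log x`). -/
theorem primeCount_ge_of_linear_le {x : ℕ} (hx : 3 ≤ x) {c : ℝ}
    (hPP : ∑ n ∈ (Icc 1 x).filter
        (fun n : ℕ => ¬Nat.Prime (n ^ 2 + 1) ∧ IsPrimePow (n ^ 2 + 1)), Λ (n ^ 2 + 1) ≤ c / 2 * x)
    (hψ : c * x ≤ ∑ n ∈ Icc 1 x, Λ (n ^ 2 + 1)) :
    c / 6 * x / Real.log x ≤ nSqAddOnePrimeCount x := by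
  have hX : (3 : ℝ) ≤ x := by exact_mod_cast hx
  have hlog1 : 1 < Real.log x := by
    rw [← Real.exp_lt_exp, Real.exp_log (by linarith)]
    exact lt_of_lt_of_le (Real.exp_one_lt_d9.trans (by norm_num)) hX
  have hlog3 : Real.log ((x : ℝ) ^ 2 + 1) ≤ 3 * Real.log x :=
    (log_sq_add_one_le (by linarith)).trans (by linarith)
  have hθ := theta_le_card_mul_log x
  rw [sum_vonMangoldt_eq_theta_add] at hψ
  have hP0 : (0 : ℝ) ≤ nSqAddOnePrimeCount x := Nat.cast_nonneg _
  have h1 : c / 2 * x ≤ nSqAddOnePrimeCount x * (3 * Real.log x) := by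
    have := mul_le_mul_of_nonneg_left hlog3 hP0
    linarith
  rw [div_le_iff₀ (by linarith)]
  linarith

/-- From `π_E` to `ψ` at a fixed `x ≥ 2` with `log x ≤ (c/2)·x^{1/2}`: if `c·x/log x ≤ π_E(x)` then
`(c/2)·x ≤ ψ(x)` (the prime values `n² + 1` with `n > x^{1/2}` each weigh `≥ log x`). -/
theorem linear_le_of_primeCount_ge {x : ℕ} (hx : 2 ≤ x) {c : ℝ}
    (hlog : Real.log x ≤ c / 2 * (x : ℝ) ^ (1 / 2 : ℝ))
    (hπ : c * x / Real.log x ≤ nSqAddOnePrimeCount x) :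
    c / 2 * x ≤ ∑ n ∈ Icc 1 x, Λ (n ^ 2 + 1) := by
  have hX : (2 : ℝ) ≤ x := by exact_mod_cast hx
  have hX0 : (0 : ℝ) < x := by linarith
  have hlog0 : 0 < Real.log x := Real.log_pos (by linarith)
  set y : ℕ := ⌊(x : ℝ) ^ (1 / 2 : ℝ)⌋₊ with hy
  have hr0 : 0 ≤ (x : ℝ) ^ (1 / 2 : ℝ) := by positivity
  have hy1 : (x : ℝ) ^ (1 / 2 : ℝ) < (y : ℝ) + 1 := Nat.lt_floor_add_one _
  have hyle : (y : ℝ) ≤ (x : ℝ) ^ (1 / 2 : ℝ) := Nat.floor_le hr0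
  have hsq : (x : ℝ) ^ (1 / 2 : ℝ) * (x : ℝ) ^ (1 / 2 : ℝ) = x := by
    rw [← Real.rpow_add hX0]; norm_num
  have hL : Real.log x ≤ 2 * Real.log ((y : ℝ) + 1) := by
    have h1 : Real.log ((x : ℝ) ^ (1 / 2 : ℝ)) ≤ Real.log ((y : ℝ) + 1) :=
      Real.log_le_log (by positivity) hy1.le
    rw [Real.log_rpow hX0] at h1
    linarith
  have hθ := card_sub_mul_le_theta x y hlog0.le hL
  rw [sum_vonMangoldt_eq_theta_add]
  have hPP := properPrimePow_sum_nonneg x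
  -- `(π_E - y) log x ≥ c x - y log x ≥ c x - x^{1/2} · (c/2) x^{1/2} = (c/2) x`
  have hπ' : c * x ≤ (nSqAddOnePrimeCount x : ℝ) * Real.log x := (div_le_iff₀ hlog0).mp hπ
  have hyl : (y : ℝ) * Real.log x ≤ c / 2 * x := by
    calc (y : ℝ) * Real.log x ≤ (x : ℝ) ^ (1 / 2 : ℝ) * (c / 2 * (x : ℝ) ^ (1 / 2 : ℝ)) :=
          mul_le_mul hyle hlog hlog0.le hr0
      _ = c / 2 * x := by rw [mul_left_comm, hsq]
  nlinarith

/-- `log x ≤ a · x^{1/2}` eventually along `ℕ`, for every `a > 0`. -/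
theorem eventually_log_le_mul_rpow_half {a : ℝ} (ha : 0 < a) :
    ∀ᶠ x : ℕ in atTop, Real.log x ≤ a * (x : ℝ) ^ (1 / 2 : ℝ) := by
  have h := (isLittleO_log_rpow_atTop (by norm_num : (0 : ℝ) < 1 / 2)).bound ha
  filter_upwards [tendsto_natCast_atTop_atTop.eventually h, eventually_ge_atTop 1] with x hx hx1
  have hX : (1 : ℝ) ≤ x := by exact_mod_cast hx1
  rwa [Real.norm_of_nonneg (Real.log_nonneg hX),
    Real.norm_of_nonneg (Real.rpow_nonneg (by linarith) _)] at hx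

/-- **Tier 1 in terms of `π_E`, along a sequence.** `ψ(x) ≥ c·x` for some `c > 0` and arbitrarily
large `x` ⟺ `π_E(x) ≥ c·x/log x` for some `c > 0` and arbitrarily large `x`. -/
theorem frequently_linear_le_iff_primeCount :
    (∃ c : ℝ, 0 < c ∧ ∃ᶠ x : ℕ in atTop, c * x ≤ ∑ n ∈ Icc 1 x, Λ (n ^ 2 + 1))
      ↔ ∃ c : ℝ, 0 < c ∧ ∃ᶠ x : ℕ in atTop, c * x / Real.log x ≤ nSqAddOnePrimeCount x := by
  constructor
  · rintro ⟨c, hc, h⟩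
    refine ⟨c / 6, by positivity, ?_⟩
    refine (h.and_eventually ((eventually_properPrimePow_sum_le (half_pos hc)).and
      (eventually_ge_atTop 3))).mono ?_
    rintro x ⟨hx, hPP, hx3⟩
    exact primeCount_ge_of_linear_le hx3 hPP hx
  · rintro ⟨c, hc, h⟩
    refine ⟨c / 2, half_pos hc, ?_⟩
    refine (h.and_eventually ((eventually_log_le_mul_rpow_half (half_pos hc)).and
      (eventually_ge_atTop 2))).mono ?_
    rintro x ⟨hx, hlog, hx2⟩
    exact linear_le_of_primeCount_ge hx2 hlog hx

/-- **Tier 1 in terms of `π_E`, eventually.** `ψ(x) ≥ c·x` for some `c > 0` and all large `x`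
⟺ `π_E(x) ≥ c·x/log x` for some `c > 0` and all large `x`. -/
theorem eventually_linear_le_iff_primeCount :
    (∃ c : ℝ, 0 < c ∧ ∀ᶠ x : ℕ in atTop, c * x ≤ ∑ n ∈ Icc 1 x, Λ (n ^ 2 + 1))
      ↔ ∃ c : ℝ, 0 < c ∧ ∀ᶠ x : ℕ in atTop, c * x / Real.log x ≤ nSqAddOnePrimeCount x := by
  constructor
  · rintro ⟨c, hc, h⟩
    refine ⟨c / 6, by positivity, ?_⟩
    filter_upwards [h, eventually_properPrimePow_sum_le (half_pos hc), eventually_ge_atTop 3]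
      with x hx hPP hx3
    exact primeCount_ge_of_linear_le hx3 hPP hx
  · rintro ⟨c, hc, h⟩
    refine ⟨c / 2, half_pos hc, ?_⟩
    filter_upwards [h, eventually_log_le_mul_rpow_half (half_pos hc), eventually_ge_atTop 2]
      with x hx hlog hx2
    exact linear_le_of_primeCount_ge hx2 hlog hx

/-- `π_E(x) ≥ c·x/log x` (`c > 0`) for arbitrarily large `x` gives Landau's conjecture:
`n² + 1` is prime for infinitely many `n`. -/
theorem landauConjecture_of_frequently_primeCount_ge {c : ℝ} (hc : 0 < c)
    (h : ∃ᶠ x : ℕ in atTop, c * x / Real.log x ≤ nSqAddOnePrimeCount x) : LandauConjecture := by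
  refine Set.infinite_of_forall_exists_gt fun m => ?_
  by_contra hcon
  push Not at hcon
  have hbound : ∀ x, (nSqAddOnePrimeCount x : ℝ) ≤ (m + 1 : ℕ) := by
    intro x
    unfold nSqAddOnePrimeCount
    exact_mod_cast (card_le_card (fun k hk => by
      simp only [mem_filter, mem_Icc, mem_range] at hk ⊢
      have := hcon k hk.2
      omega)).trans (card_range (m + 1)).le
  have hlim : Tendsto (fun x : ℕ => c * x / Real.log x) atTop atTop := by
    have := tendsto_natCast_div_log_atTop.const_mul_atTop hc
    simpa [mul_div_assoc] using this
  obtain ⟨x, hx, hx'⟩ := (h.and_eventually (hlim.eventually_gt_atTop ((m + 1 : ℕ) : ℝ))).exists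
  exact absurd (hx'.trans_le hx) (not_lt.mpr (hbound x))

/-- **Landau's conjecture from any constant saving.** If, for one `0 < ε < 1` and one `c > 0`,
`∑_{n ≤ x} ∑_{d ∣ n²+1, d > ⌊x^{1-ε}⌋} μ(d) log d ≤ (𝔖 - c)·x` for arbitrarily large `x`
(the trivial bound being `(𝔖 + o(1))·x`, `eventually_largeDivisorSum_le`), then `n² + 1` is prime
for infinitely many `n` — indeed `π_E(x) ≥ c'·x/log x` along those `x`. -/
theorem landauConjecture_of_frequently_largeDivisorSum_le {ε : ℝ} (hε : 0 < ε) (hε1 : ε < 1)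
    {c : ℝ} (hc : 0 < c)
    (h : ∃ᶠ x : ℕ in atTop,
      ∑ n ∈ Icc 1 x, ∑ e ∈ (n ^ 2 + 1).divisors with ⌊(x : ℝ) ^ (1 - ε)⌋₊ < (n ^ 2 + 1) / e,
          (μ ((n ^ 2 + 1) / e) : ℝ) * Real.log (((n ^ 2 + 1) / e : ℕ) : ℝ)
        ≤ (hardyLittlewoodEConst - c) * x) :
    LandauConjecture := by
  obtain ⟨c', hc', h'⟩ := frequently_linear_le_iff_primeCount.mp
    ((frequently_linear_le_iff_largeDivisorSum hε hε1).mpr ⟨c, hc, h⟩)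
  exact landauConjecture_of_frequently_primeCount_ge hc' h'

/-! ### Tier 2: the sharp one-sided constants -/

/-- **Tier 2, upper side.** `ψ(x) ≤ (𝔖 + o(1))·x` ⟺ `T(x) ≥ -o(x)`. -/
theorem upper_iff_largeDivisorSum_ge {ε : ℝ} (hε : 0 < ε) (hε1 : ε < 1) :
    (∀ δ : ℝ, 0 < δ → ∀ᶠ x : ℕ in atTop,
        ∑ n ∈ Icc 1 x, Λ (n ^ 2 + 1) ≤ (hardyLittlewoodEConst + δ) * x)
      ↔ ∀ δ : ℝ, 0 < δ → ∀ᶠ x : ℕ in atTop,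
          -(δ * x) ≤ ∑ n ∈ Icc 1 x,
            ∑ e ∈ (n ^ 2 + 1).divisors with ⌊(x : ℝ) ^ (1 - ε)⌋₊ < (n ^ 2 + 1) / e,
              (μ ((n ^ 2 + 1) / e) : ℝ) * Real.log (((n ^ 2 + 1) / e : ℕ) : ℝ) := by
  constructor
  · intro h δ hδ
    filter_upwards [h (δ / 2) (half_pos hδ), eventually_abs_mainError_le hε hε1 (half_pos hδ)]
      with x hx hE
    have hid := sum_vonMangoldt_eq_main_sub_largeDivisorSum x ε
    have := (abs_le.mp hE).1
    linarith
  · intro h δ hδ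
    filter_upwards [h (δ / 2) (half_pos hδ), eventually_abs_mainError_le hε hε1 (half_pos hδ)]
      with x hx hE
    have hid := sum_vonMangoldt_eq_main_sub_largeDivisorSum x ε
    have := (abs_le.mp hE).2
    linarith

/-- **Tier 2, lower side.** `ψ(x) ≥ (𝔖 - o(1))·x` ⟺ `T(x) ≤ o(x)`. -/
theorem lower_iff_largeDivisorSum_le {ε : ℝ} (hε : 0 < ε) (hε1 : ε < 1) :
    (∀ δ : ℝ, 0 < δ → ∀ᶠ x : ℕ in atTop,
        (hardyLittlewoodEConst - δ) * x ≤ ∑ n ∈ Icc 1 x, Λ (n ^ 2 + 1))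
      ↔ ∀ δ : ℝ, 0 < δ → ∀ᶠ x : ℕ in atTop,
          ∑ n ∈ Icc 1 x, ∑ e ∈ (n ^ 2 + 1).divisors with ⌊(x : ℝ) ^ (1 - ε)⌋₊ < (n ^ 2 + 1) / e,
              (μ ((n ^ 2 + 1) / e) : ℝ) * Real.log (((n ^ 2 + 1) / e : ℕ) : ℝ)
            ≤ δ * x := by
  constructor
  · intro h δ hδ
    filter_upwards [h (δ / 2) (half_pos hδ), eventually_abs_mainError_le hε hε1 (half_pos hδ)]
      with x hx hE
    have hid := sum_vonMangoldt_eq_main_sub_largeDivisorSum x ε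
    have := (abs_le.mp hE).2
    linarith
  · intro h δ hδ
    filter_upwards [h (δ / 2) (half_pos hδ), eventually_abs_mainError_le hε hε1 (half_pos hδ)]
      with x hx hE
    have hid := sum_vonMangoldt_eq_main_sub_largeDivisorSum x ε
    have := (abs_le.mp hE).1
    linarith

/-! ### Tier 3: both sides = Hardy–Littlewood's Conjecture E -/

/-- **Tier 3.** Conjecture E ⟺ both one-sided bounds of Tier 2: `-o(x) ≤ T(x) ≤ o(x)`. -/
theorem hardyLittlewoodConjE_iff_largeDivisorSum_twoSided {ε : ℝ} (hε : 0 < ε) (hε1 : ε < 1) :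
    HardyLittlewoodConjE ↔
      (∀ δ : ℝ, 0 < δ → ∀ᶠ x : ℕ in atTop,
          -(δ * x) ≤ ∑ n ∈ Icc 1 x,
            ∑ e ∈ (n ^ 2 + 1).divisors with ⌊(x : ℝ) ^ (1 - ε)⌋₊ < (n ^ 2 + 1) / e,
              (μ ((n ^ 2 + 1) / e) : ℝ) * Real.log (((n ^ 2 + 1) / e : ℕ) : ℝ))
      ∧ ∀ δ : ℝ, 0 < δ → ∀ᶠ x : ℕ in atTop,
          ∑ n ∈ Icc 1 x, ∑ e ∈ (n ^ 2 + 1).divisors with ⌊(x : ℝ) ^ (1 - ε)⌋₊ < (n ^ 2 + 1) / e,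
              (μ ((n ^ 2 + 1) / e) : ℝ) * Real.log (((n ^ 2 + 1) / e : ℕ) : ℝ)
            ≤ δ * x := by
  rw [hardyLittlewoodConjE_iff_largeDivisorSum_isLittleO hε hε1, isLittleO_iff]
  constructor
  · intro h
    refine ⟨fun δ hδ => ?_, fun δ hδ => ?_⟩
    · filter_upwards [h hδ] with x hx
      rw [Real.norm_eq_abs, Real.norm_eq_abs, Nat.abs_cast] at hx
      exact (abs_le.mp hx).1
    · filter_upwards [h hδ] with x hx
      rw [Real.norm_eq_abs, Real.norm_eq_abs, Nat.abs_cast] at hx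
      exact (abs_le.mp hx).2
  · rintro ⟨h1, h2⟩ δ hδ
    filter_upwards [h1 δ hδ, h2 δ hδ] with x hx1 hx2
    rw [Real.norm_eq_abs, Real.norm_eq_abs, Nat.abs_cast]
    exact abs_le.mpr ⟨hx1, hx2⟩

end Summit.Parity.BatemanHorn.Theorems
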